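import Literature.NumberTheory.LFunctions.DobnerTheorem4Proofs
import Literature.Analysis.SpecialFunctions.GammaRatioStirling
import Mathlib.Analysis.SpecialFunctions.Gaussian.GaussianIntegral
import Mathlib.Analysis.SpecialFunctions.Gamma.BohrMollerup
import Mathlib.Analysis.SpecialFunctions.Pow.Asymptotics
import HarnessLib

/-!
# Tools for Dobner's Lemma 4 (steepest descent for `B_{t,n}(s)`), I: growth bounds

Trunk T-ANT (`Literature/NumberTheory/LFunctions`). Proofs only (no named facts), first of the
files discharging the named fact `Literature.NumberTheory.LFunctions.dobner_lemma4` (A. Dobner, *A proof of Newman's conjecture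
for the extended Selberg class*, Acta Arith. 201 (2021) = arXiv:2005.05142, **Lemma 4**, for
`F = ζ`), the last leaf below `Literature.NumberTheory.LFunctions.rodgers_tao` (`Λ ≥ 0`) on Dobner's route
(`Literature.NumberTheory.LFunctions.rodgers_tao_of_dobner_lemma4`).

Contents: an `atTop`-toolkit for "`y` sufficiently large" bookkeeping; the crude bound
`‖Γ(w)‖ ≤ R^R` (`Im w ≥ 1`, `Re w ≤ R`, `R ≥ 2`; from `Γ(u) ≤ u^u`, `Literature.NumberTheory.LFunctions.Real.Gamma_le_rpow_self`)
replacing Stirling's formula in Lemmas 1, 6, 7 of the source; real/imaginary parts of `J_t(s)`; a lower bound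
`‖γ(s)‖ ≥ e^{−4 Im s}` in the region `|Re s| ≤ C (Im s)^{1/4}` (substitute for Lemma 1 there);
Dobner's `A = 1/|t| + 1/(4s)`, the saddle-point shift `λ = log n/(2A)` and centre `c = s + λ`
(`Literature.NumberTheory.LFunctions.dobnerA`, `Literature.NumberTheory.LFunctions.dobnerShift`, `Literature.NumberTheory.LFunctions.dobnerCenter`, proof of Lemma 4, p. 11); the
integrand `𝓘(z) = γ(z) n^{−z} e^{(J_t(s)−z)²/|t|}` of `B_{t,n}(s)` (`Literature.NumberTheory.LFunctions.dobnerI`, eq. (4.1) and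
Lemma 6), its modulus, holomorphy off the closed negative real axis, bounds and integrability on
vertical lines `Re z = σ > 0`, and the vertical line-shifting identity inside `Re z > 0` (used
for part (iii)). The four definitions are auxiliary notation for the proof of the named fact
`Literature.NumberTheory.LFunctions.dobner_lemma4` (whose statement, in `DobnerSteepestDescent.lean`, does not use them).

## References

* [Dobner2021] A. Dobner, Acta Arith. 201 (2021), 29–62, §4 (Lemma 4, eq. (4.1)) and §5
  (Lemmas 1, 5, 6, 7); arXiv:2005.05142, pp. 10–17.
-/

noncomputable section

open Complex Filter Topology Set MeasureTheory Asymptotics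

namespace Literature.NumberTheory.LFunctions

/-! ## "For all sufficiently large `y`": comparison of powers and logarithms -/

/-- `c y^p ≤ y^q` for all large `y`, if `p < q`. [folklore] -/
theorem eventually_const_mul_rpow_le_rpow (c : ℝ) {p q : ℝ} (h : p < q) :
    ∀ᶠ y : ℝ in atTop, c * y ^ p ≤ y ^ q := by
  have h1 : Tendsto (fun y : ℝ ↦ y ^ (q - p)) atTop atTop := tendsto_rpow_atTop (by linarith)
  filter_upwards [h1.eventually_ge_atTop c, eventually_ge_atTop (1 : ℝ)] with y hy hy1
  have hy0 : 0 < y := by linarith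
  calc c * y ^ p ≤ y ^ (q - p) * y ^ p :=
        mul_le_mul_of_nonneg_right hy (Real.rpow_nonneg hy0.le _)
    _ = y ^ q := by rw [← Real.rpow_add hy0]; ring_nf

/-- `c y^p log y ≤ y^q` for all large `y`, if `p < q`. [folklore] -/
theorem eventually_const_mul_rpow_mul_log_le_rpow (c : ℝ) {p q : ℝ} (h : p < q) :
    ∀ᶠ y : ℝ in atTop, c * y ^ p * Real.log y ≤ y ^ q := by
  have hr : 0 < (q - p) / 2 := by linarith
  have h1 := (isLittleO_log_rpow_atTop hr).bound one_pos
  have h2 := eventually_const_mul_rpow_le_rpow |c| (show p + (q - p) / 2 < q by linarith)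
  filter_upwards [h1, h2, eventually_ge_atTop (1 : ℝ)] with y hlog hc hy1
  have hy0 : 0 < y := by linarith
  have hlog' : Real.log y ≤ y ^ ((q - p) / 2) := by
    rw [one_mul, Real.norm_eq_abs, Real.norm_eq_abs, abs_of_nonneg (Real.log_nonneg hy1),
      abs_of_nonneg (Real.rpow_nonneg hy0.le _)] at hlog
    exact hlog
  have hp0 : 0 ≤ y ^ p := Real.rpow_nonneg hy0.le _
  have hl0 : 0 ≤ Real.log y := Real.log_nonneg hy1
  calc c * y ^ p * Real.log y ≤ |c| * y ^ p * Real.log y := by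
        gcongr; exact le_abs_self c
    _ ≤ |c| * y ^ p * y ^ ((q - p) / 2) := by gcongr
    _ = |c| * y ^ (p + (q - p) / 2) := by rw [Real.rpow_add hy0]; ring
    _ ≤ y ^ q := hc

/-- `c ≤ y^q` for all large `y`, if `q > 0`. [folklore] -/
theorem eventually_const_le_rpow (c : ℝ) {q : ℝ} (hq : 0 < q) : ∀ᶠ y : ℝ in atTop, c ≤ y ^ q :=
  (tendsto_rpow_atTop hq).eventually_ge_atTop c

/-- `c log y ≤ y^q` for all large `y`, if `q > 0`. [folklore] -/
theorem eventually_const_mul_log_le_rpow (c : ℝ) {q : ℝ} (hq : 0 < q) :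
    ∀ᶠ y : ℝ in atTop, c * Real.log y ≤ y ^ q := by
  filter_upwards [eventually_const_mul_rpow_mul_log_le_rpow c hq, eventually_ge_atTop (0 : ℝ)]
    with y h hy
  simpa [Real.rpow_zero] using h

/-! ## Crude bounds for `Γ` replacing Stirling's formula -/

-- `Γ ≤ 1` on `[1, 2]` and `Γ(u) ≤ u^u` for `u ≥ 1` are `Literature.NumberTheory.LFunctions.Real.Gamma_le_one_of_mem_Icc` and
-- `Literature.NumberTheory.LFunctions.Real.Gamma_le_rpow_self` (`RiemannXiOrderProofs.lean`).

/-- `‖Γ(w)‖ ≤ 1` for `Im w ≥ 1` and `Re w < 1` (recurrence `Γ(w) = Γ(w+1)/w`, `‖w‖ ≥ 1`, down to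
`Re ∈ [1, 2)` where `‖Γ‖ ≤ Γ(Re) ≤ 1`). [folklore] -/
theorem norm_Gamma_le_one_of_re_lt_one (m : ℕ) :
    ∀ {w : ℂ}, 1 ≤ w.im → -(m : ℝ) ≤ w.re → w.re < 1 → ‖Complex.Gamma w‖ ≤ 1 := by
  -- one step of the recurrence
  have hstep : ∀ {w : ℂ}, 1 ≤ w.im → ‖Complex.Gamma w‖ ≤ ‖Complex.Gamma (w + 1)‖ := by
    intro w hw
    have hw0 : w ≠ 0 := fun h ↦ by
      have h' := hw; rw [h, Complex.zero_im] at h'; linarith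
    have h1 : 1 ≤ ‖w‖ := by
      have := Complex.abs_im_le_norm w
      rw [abs_of_pos (by linarith : 0 < w.im)] at this
      linarith
    rw [Complex.Gamma_add_one w hw0, norm_mul]
    exact le_mul_of_one_le_left (norm_nonneg _) h1
  -- the base strip `0 ≤ Re w < 1`
  have hbase : ∀ {w : ℂ}, 1 ≤ w.im → 0 ≤ w.re → w.re < 1 → ‖Complex.Gamma w‖ ≤ 1 := by
    intro w hw h0 h1
    refine (hstep hw).trans ?_
    have h := norm_Gamma_le_Gamma_re (s := w + 1) (by simp; linarith)
    simp only [Complex.add_re, Complex.one_re] at h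
    exact h.trans (Real.Gamma_le_one_of_mem_Icc (by linarith) (by linarith))
  induction m with
  | zero => intro w hw h0 h1; exact hbase hw (by simpa using h0) h1
  | succ m ih =>
    intro w hw h0 h1
    rcases le_or_gt (-(m : ℝ)) w.re with h | h
    · exact ih hw h h1
    · refine (hstep hw).trans (ih (w := w + 1) (by simpa using hw) ?_ ?_)
      · push_cast at h0; simp; linarith
      · simp; linarith

/-- **`‖Γ(w)‖ ≤ R^R` for `Im w ≥ 1`, `Re w ≤ R`, `R ≥ 2`** (`‖Γ(w)‖ ≤ Γ(Re w) ≤ (Re w)^{Re w}` if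
`Re w ≥ 1`, `‖Γ(w)‖ ≤ 1` otherwise). [folklore] -/
theorem norm_Gamma_le_rpow_of_im {w : ℂ} {R : ℝ} (hw : 1 ≤ w.im) (hre : w.re ≤ R) (hR : 2 ≤ R) :
    ‖Complex.Gamma w‖ ≤ R ^ R := by
  have hR1 : 1 ≤ R := by linarith
  rcases lt_or_ge w.re 1 with h | h
  · have hm : -((⌈-w.re⌉₊ : ℕ) : ℝ) ≤ w.re := by
      have := Nat.le_ceil (-w.re); linarith
    exact (norm_Gamma_le_one_of_re_lt_one ⌈-w.re⌉₊ hw hm h).trans (Real.one_le_rpow hR1 (by linarith))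
  · have h1 := norm_Gamma_le_Gamma_re (s := w) (by linarith)
    calc ‖Complex.Gamma w‖ ≤ Real.Gamma w.re := h1
      _ ≤ w.re ^ w.re := Real.Gamma_le_rpow_self h
      _ ≤ R ^ w.re := Real.rpow_le_rpow (by linarith) hre (by linarith)
      _ ≤ R ^ R := Real.rpow_le_rpow_of_exponent_le hR1 hre

/-- `‖γ(z)‖ ≤ (‖z‖ + 1)² π^{R/2} R^R` for `Im z ≥ 2`, `|Re z| ≤ R`, `R ≥ 2`
(`γ(z) = ½ z(z−1) π^{-z/2} Γ(z/2)`). [folklore] -/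
theorem norm_xiGammaFactor_le_of_im {z : ℂ} {R : ℝ} (hz : 2 ≤ z.im) (hre : |z.re| ≤ R)
    (hR : 2 ≤ R) : ‖xiGammaFactor z‖ ≤ (‖z‖ + 1) ^ 2 * Real.pi ^ (R / 2) * R ^ R := by
  have hR0 : 0 ≤ R := by linarith
  rw [xiGammaFactor, norm_mul, norm_div, norm_mul, Gammaℝ_def, norm_mul, Complex.norm_two]
  have h1 : ‖z - 1‖ ≤ ‖z‖ + 1 := by
    calc ‖z - 1‖ ≤ ‖z‖ + ‖(1 : ℂ)‖ := norm_sub_le _ _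
      _ = ‖z‖ + 1 := by rw [norm_one]
  have h2 : ‖(Real.pi : ℂ) ^ (-z / 2)‖ ≤ Real.pi ^ (R / 2) := by
    rw [Complex.norm_cpow_eq_rpow_re_of_pos Real.pi_pos]
    refine Real.rpow_le_rpow_of_exponent_le (by linarith [Real.pi_gt_three]) ?_
    have : (-z / 2).re = -z.re / 2 := by simp
    rw [this]
    linarith [neg_abs_le z.re, (abs_le.1 hre).1]
  have h3 : ‖Complex.Gamma (z / 2)‖ ≤ R ^ R := by
    refine norm_Gamma_le_rpow_of_im (by simp; linarith) ?_ hR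
    simp only [Complex.div_ofNat_re]
    linarith [le_abs_self z.re]
  have hz0 : 0 ≤ ‖z‖ := norm_nonneg _
  have hpi : 0 ≤ Real.pi ^ (R / 2) := Real.rpow_nonneg Real.pi_pos.le _
  have hRR : 0 ≤ R ^ R := Real.rpow_nonneg hR0 _
  have hA : ‖z‖ * ‖z - 1‖ / 2 ≤ (‖z‖ + 1) ^ 2 := by
    nlinarith [norm_nonneg (z - 1), mul_le_mul_of_nonneg_left h1 hz0]
  have hB : ‖(Real.pi : ℂ) ^ (-z / 2)‖ * ‖Complex.Gamma (z / 2)‖ ≤ Real.pi ^ (R / 2) * R ^ R :=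
    mul_le_mul h2 h3 (norm_nonneg _) hpi
  calc ‖z‖ * ‖z - 1‖ / 2 * (‖(Real.pi : ℂ) ^ (-z / 2)‖ * ‖Complex.Gamma (z / 2)‖)
      ≤ (‖z‖ + 1) ^ 2 * (Real.pi ^ (R / 2) * R ^ R) :=
        mul_le_mul hA hB (mul_nonneg (norm_nonneg _) (norm_nonneg _)) (by positivity)
    _ = (‖z‖ + 1) ^ 2 * Real.pi ^ (R / 2) * R ^ R := by ring

/-! ## Real and imaginary parts of `J_t(s)` -/

/-- `Im J_t(s) = Im s + (|t|/4) Arg(s/(2π))`. [folklore] -/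
theorem dobnerJ_im (t : ℝ) (s : ℂ) :
    (dobnerJ t s).im = s.im + |t| / 4 * Complex.arg (s / (2 * Real.pi)) := by
  rw [dobnerJ, Complex.add_im, Complex.im_ofReal_mul, Complex.log_im]

/-- For `Im s > 0`: `Im s ≤ Im J_t(s) ≤ Im s + π|t|/4`. [folklore] -/
theorem dobnerJ_im_mem (t : ℝ) {s : ℂ} (hs : 0 < s.im) :
    s.im ≤ (dobnerJ t s).im ∧ (dobnerJ t s).im ≤ s.im + Real.pi * |t| / 4 := by
  rw [dobnerJ_im]
  have him : 0 < (s / (2 * Real.pi)).im := by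
    rw [show (2 * (Real.pi : ℂ)) = ((2 * Real.pi : ℝ) : ℂ) by push_cast; rfl, Complex.div_ofReal_im]
    positivity
  have h0 : 0 ≤ Complex.arg (s / (2 * Real.pi)) := Complex.arg_nonneg_iff.2 him.le
  have h1 : Complex.arg (s / (2 * Real.pi)) ≤ Real.pi := Complex.arg_le_pi _
  have ht : 0 ≤ |t| / 4 := by positivity
  constructor <;> nlinarith

/-- For `Im s ≥ 2π` and `|Re s| ≤ Im s`: `|Re J_t(s) − Re s| ≤ (|t|/4) log(Im s)`. [folklore] -/
theorem abs_dobnerJ_re_sub_re_le (t : ℝ) {s : ℂ} (hy : 2 * Real.pi ≤ s.im) (hx : |s.re| ≤ s.im) :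
    |(dobnerJ t s).re - s.re| ≤ |t| / 4 * Real.log s.im := by
  have hpi := Real.pi_gt_three
  have hy0 : 0 < s.im := by linarith
  rw [dobnerJ_re, add_sub_cancel_left]
  have hn1 : s.im ≤ ‖s‖ := by simpa [abs_of_pos hy0] using Complex.abs_im_le_norm s
  have hn2 : ‖s‖ ≤ 2 * s.im := by
    calc ‖s‖ ≤ |s.re| + |s.im| := Complex.norm_le_abs_re_add_abs_im s
      _ ≤ s.im + s.im := by rw [abs_of_pos hy0]; linarith
      _ = 2 * s.im := by ring
  have hq1 : 1 ≤ ‖s‖ / (2 * Real.pi) := by rw [le_div_iff₀ (by positivity)]; linarith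
  have hq2 : ‖s‖ / (2 * Real.pi) ≤ s.im := by
    rw [div_le_iff₀ (by positivity)]; nlinarith
  have hlog0 : 0 ≤ Real.log (‖s‖ / (2 * Real.pi)) := Real.log_nonneg hq1
  have hlog1 : Real.log (‖s‖ / (2 * Real.pi)) ≤ Real.log s.im :=
    Real.log_le_log (by positivity) hq2
  rw [abs_of_nonneg (by positivity)]
  exact mul_le_mul_of_nonneg_left hlog1 (by positivity)

/-! ## A lower bound for `‖γ(s)‖` in the region `|Re s| ≤ C (Im s)^{1/4}` -/

/-- **`e^{−4 Im s} ≤ ‖γ(s)‖` for `|Re s| ≤ C (Im s)^{1/4}` and `Im s` large** (an elementary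
substitute for the lower half of [Dobner2021, Lemma 1] in this region: reflection formula and
recurrence via `Literature.NumberTheory.LFunctions.norm_Gamma_ge_uniform`, no Stirling). [folklore] -/
theorem exists_exp_neg_four_mul_le_norm_xiGammaFactor {C : ℝ} (hC : 0 < C) :
    ∃ y₀ : ℝ, ∀ s : ℂ, |s.re| ≤ C * s.im ^ (1 / 4 : ℝ) → y₀ ≤ s.im →
      Real.exp (-4 * s.im) ≤ ‖xiGammaFactor s‖ := by
  have hpi := Real.pi_gt_three
  have hlpi : 0 < Real.log Real.pi := Real.log_pos (by linarith)
  -- largeness conditions on `y = Im s`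
  have hev : ∀ᶠ y : ℝ in atTop, 2 * Real.pi ≤ y ∧ C * y ^ (1 / 4 : ℝ) + 2 ≤ y / 2 ∧
      (3 * (C * Real.log Real.pi / 2) / 2) * y ^ (1 / 4 : ℝ) ≤ y ∧
      (3 * C / 2) * y ^ (1 / 4 : ℝ) * Real.log y ≤ y ∧ 6 * Real.log y ≤ y := by
    have e1 := eventually_ge_atTop (2 * Real.pi)
    have e2 : ∀ᶠ y : ℝ in atTop, C * y ^ (1 / 4 : ℝ) + 2 ≤ y / 2 := by
      filter_upwards [eventually_const_mul_rpow_le_rpow (4 * C) (by norm_num : (1 / 4 : ℝ) < 1),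
        eventually_ge_atTop (8 : ℝ)] with y h1 h2
      rw [Real.rpow_one] at h1; linarith
    have e3 := eventually_const_mul_rpow_le_rpow (3 * (C * Real.log Real.pi / 2) / 2)
      (by norm_num : (1 / 4 : ℝ) < 1)
    have e4 := eventually_const_mul_rpow_mul_log_le_rpow (3 * C / 2) (by norm_num : (1 / 4 : ℝ) < 1)
    have e5 := eventually_const_mul_log_le_rpow 6 (by norm_num : (0 : ℝ) < 1)
    filter_upwards [e1, e2, e3, e4, e5] with y h1 h2 h3 h4 h5
    simp only [Real.rpow_one] at h3 h4 h5
    exact ⟨h1, h2, h3, h4, h5⟩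
  obtain ⟨y₀, hy₀⟩ := eventually_atTop.1 hev
  refine ⟨y₀, fun s hx hy ↦ ?_⟩
  obtain ⟨h1, h2, h3, h4, h5⟩ := hy₀ s.im hy
  set y : ℝ := s.im with hydef
  have hy0 : 0 < y := by linarith
  have hy1 : 1 ≤ y := by linarith
  have hq0 : 0 ≤ y ^ (1 / 4 : ℝ) := Real.rpow_nonneg hy0.le _
  -- the `Γ(s/2)` factor
  set S : ℝ := C * y ^ (1 / 4 : ℝ) / 2 with hS
  have hS0 : 0 ≤ S := by positivity
  set N : ℕ := ⌈S⌉₊ + 1 with hN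
  have hNle : (N : ℝ) ≤ S + 2 := by
    rw [hN]; push_cast; linarith [Nat.ceil_lt_add_one hS0]
  have hw_re : |(s / 2).re| ≤ S := by
    simp only [Complex.div_ofNat_re, abs_div, abs_two]; rw [hS]; linarith
  have hw_im : 1 ≤ (s / 2).im := by simp only [Complex.div_ofNat_im]; rw [← hydef]; linarith
  have hG := norm_Gamma_ge_uniform hS0 hw_re hw_im
  simp only [Complex.div_ofNat_im] at hG
  rw [← hN, ← hydef] at hG
  -- lower bound for the polynomial factor `(S + N + y/2)^{-N} ≥ exp(-(S+2) log(2y))` hmm via `(2y)^{-(S+2)}`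
  have hB1 : 1 ≤ S + N + y / 2 := by
    have : (1 : ℝ) ≤ N := by rw [hN]; exact_mod_cast Nat.le_add_left 1 _
    linarith
  have hB2 : S + N + y / 2 ≤ 2 * y := by linarith
  have hfac : Real.exp (-((S + 2) * Real.log (2 * y))) ≤ (S + N + y / 2) ^ (-(N : ℝ)) := by
    rw [Real.rpow_def_of_pos (by linarith), Real.exp_le_exp]
    have hl0 : 0 ≤ Real.log (S + N + y / 2) := Real.log_nonneg hB1
    have hl1 : Real.log (S + N + y / 2) ≤ Real.log (2 * y) := Real.log_le_log (by linarith) hB2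
    have hN0 : (0 : ℝ) ≤ N := N.cast_nonneg
    nlinarith
  -- assemble `‖γ(s)‖ = ‖s‖ ‖s-1‖ / 2 · π^{-x/2} · ‖Γ(s/2)‖`
  rw [xiGammaFactor, norm_mul, norm_div, norm_mul, Gammaℝ_def, norm_mul, Complex.norm_two,
    Complex.norm_cpow_eq_rpow_re_of_pos Real.pi_pos]
  have hns : y ≤ ‖s‖ := by
    have := Complex.abs_im_le_norm s
    rwa [← hydef, abs_of_pos hy0] at this
  have hns1 : y ≤ ‖s - 1‖ := by
    have := Complex.abs_im_le_norm (s - 1)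
    simp only [Complex.sub_im, Complex.one_im, sub_zero] at this
    rwa [← hydef, abs_of_pos hy0] at this
  have hpoly : 1 ≤ ‖s‖ * ‖s - 1‖ / 2 := by
    rw [le_div_iff₀ (by norm_num : (0 : ℝ) < 2)]
    nlinarith
  have hpi_fac : Real.exp (-(C * Real.log Real.pi / 2) * y ^ (1 / 4 : ℝ)) ≤ Real.pi ^ (-s / 2).re := by
    rw [Real.rpow_def_of_pos Real.pi_pos, Real.exp_le_exp]
    have : (-s / 2).re = -s.re / 2 := by simp
    rw [this]
    have := (abs_le.1 hx).2
    nlinarith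
  -- combine the exponentials
  have hkey : Real.exp (-4 * y) ≤ Real.exp (-(C * Real.log Real.pi / 2) * y ^ (1 / 4 : ℝ)) *
      (Real.pi * Real.exp (-(Real.pi * (y / 2))) * Real.exp (-((S + 2) * Real.log (2 * y)))) := by
    have hpy : Real.pi * y ≤ 4 * y := mul_le_mul_of_nonneg_right Real.pi_le_four hy0.le
    have epi : Real.pi = Real.exp (Real.log Real.pi) := (Real.exp_log Real.pi_pos).symm
    rw [epi, ← Real.exp_add, ← Real.exp_add, ← Real.exp_add, Real.exp_le_exp, ← epi]
    have hlog2y : Real.log (2 * y) ≤ 2 * Real.log y := by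
      rw [Real.log_mul (by norm_num) hy0.ne']
      have : Real.log 2 ≤ Real.log y := Real.log_le_log (by norm_num) (by linarith)
      linarith
    have hlogy : 0 ≤ Real.log y := Real.log_nonneg hy1
    have hSl : (S + 2) * Real.log (2 * y) ≤ (C * y ^ (1 / 4 : ℝ) + 4) * Real.log y := by
      calc (S + 2) * Real.log (2 * y) ≤ (S + 2) * (2 * Real.log y) :=
            mul_le_mul_of_nonneg_left hlog2y (by positivity)
        _ = (C * y ^ (1 / 4 : ℝ) + 4) * Real.log y := by rw [hS]; ring
    nlinarith [mul_nonneg hC.le hq0]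
  calc Real.exp (-4 * s.im) = Real.exp (-4 * y) := by rw [hydef]
    _ ≤ Real.exp (-(C * Real.log Real.pi / 2) * y ^ (1 / 4 : ℝ)) *
        (Real.pi * Real.exp (-(Real.pi * (y / 2))) * Real.exp (-((S + 2) * Real.log (2 * y)))) := hkey
    _ ≤ Real.pi ^ (-s / 2).re *
        (Real.pi * Real.exp (-(Real.pi * (y / 2))) * (S + N + y / 2) ^ (-(N : ℝ))) := by
        gcongr
    _ ≤ Real.pi ^ (-s / 2).re * ‖Complex.Gamma (s / 2)‖ := by
        gcongr
    _ ≤ ‖s‖ * ‖s - 1‖ / 2 * (Real.pi ^ (-s / 2).re * ‖Complex.Gamma (s / 2)‖) :=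
        le_mul_of_one_le_left (by positivity) hpoly

/-- `‖γ_t(s)‖ ≥ e^{−π²|t|/16} ‖γ(s)‖` (`γ_t = γ · e^{(s−J)²/|t|}`, `Literature.NumberTheory.LFunctions.re_sq_sub_dobnerJ_ge`).
[folklore] -/
theorem norm_xiGammaFactor_le_norm_dobnerGammaT (t : ℝ) (s : ℂ) :
    Real.exp (-(Real.pi ^ 2 * |t| / 16)) * ‖xiGammaFactor s‖ ≤ ‖dobnerGammaT t s‖ := by
  rw [dobnerGammaT, norm_mul, Complex.norm_exp, mul_comm]
  exact mul_le_mul_of_nonneg_left (Real.exp_le_exp.2 (re_sq_sub_dobnerJ_ge t s)) (norm_nonneg _)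

/-! ## `A`, the shift `λ = log n/(2A)` and the centre `c = s + λ` -/

/-- Dobner's `A = 1/|t| + 1/(4s)` (for `F = ζ`: `Σ ω_j/(2s) = 1/(4s)`). [cite: Dobner2021, §4 (heuristic) and proof of Lemma 4] -/
def dobnerA (t : ℝ) (s : ℂ) : ℂ := ((1 / |t| : ℝ) : ℂ) + 1 / (4 * s)

/-- The shift `λ = log n/(2A)` of the saddle point. [cite: Dobner2021, proof of Lemma 4] -/
def dobnerShift (t : ℝ) (n : ℕ) (s : ℂ) : ℂ := (Real.log n : ℂ) / (2 * dobnerA t s)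

/-- The saddle point `c = s + log n/(2A)` through which the contour is shifted.
[cite: Dobner2021, proof of Lemma 4] -/
def dobnerCenter (t : ℝ) (n : ℕ) (s : ℂ) : ℂ := s + dobnerShift t n s

/-- `‖1/(4s)‖ ≤ 1/(4 Im s)`. [folklore] -/
theorem norm_inv_four_mul_le {s : ℂ} (hs : 0 < s.im) : ‖1 / (4 * s)‖ ≤ 1 / (4 * s.im) := by
  have hns : s.im ≤ ‖s‖ := by simpa [abs_of_pos hs] using Complex.abs_im_le_norm s
  rw [norm_div, norm_one, norm_mul, Complex.norm_ofNat]
  exact div_le_div_of_nonneg_left zero_le_one (by positivity) (by linarith)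

/-- `‖A − 1/|t|‖ ≤ 1/(4 Im s)`. [folklore] -/
theorem norm_dobnerA_sub_le (t : ℝ) {s : ℂ} (hs : 0 < s.im) :
    ‖dobnerA t s - (1 / |t| : ℝ)‖ ≤ 1 / (4 * s.im) := by
  rw [dobnerA, add_sub_cancel_left]; exact norm_inv_four_mul_le hs

/-- `Re A ≥ 1/(2|t|)` once `Im s ≥ |t|/2`. [folklore] -/
theorem dobnerA_re_ge {t : ℝ} (ht : t ≠ 0) {s : ℂ} (hs0 : 0 < s.im) (hs : |t| / 2 ≤ s.im) :
    1 / (2 * |t|) ≤ (dobnerA t s).re := by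
  have ht' : 0 < |t| := abs_pos.2 ht
  have h1 : |(1 / (4 * s)).re| ≤ 1 / (4 * s.im) :=
    (Complex.abs_re_le_norm _).trans (norm_inv_four_mul_le hs0)
  have h2 : 1 / (4 * s.im) ≤ 1 / (2 * |t|) :=
    div_le_div_of_nonneg_left zero_le_one (by positivity) (by linarith)
  rw [dobnerA, Complex.add_re, Complex.ofReal_re]
  have := neg_abs_le (1 / (4 * s)).re
  have e : 1 / |t| = 1 / (2 * |t|) + 1 / (2 * |t|) := by field_simp; norm_num
  linarith

/-- `‖A‖ ≥ 1/(2|t|)`, in particular `A ≠ 0`. [folklore] -/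
theorem norm_dobnerA_ge {t : ℝ} (ht : t ≠ 0) {s : ℂ} (hs0 : 0 < s.im) (hs : |t| / 2 ≤ s.im) :
    1 / (2 * |t|) ≤ ‖dobnerA t s‖ :=
  (dobnerA_re_ge ht hs0 hs).trans (Complex.re_le_norm _)

/-- `A ≠ 0` once `Im s ≥ |t|/2`. [folklore] -/
theorem dobnerA_ne_zero {t : ℝ} (ht : t ≠ 0) {s : ℂ} (hs0 : 0 < s.im) (hs : |t| / 2 ≤ s.im) :
    dobnerA t s ≠ 0 := by
  have h1 := norm_dobnerA_ge ht hs0 hs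
  have ht' : 0 < 1 / (2 * |t|) := div_pos one_pos (by linarith [abs_pos.2 ht])
  exact norm_pos_iff.1 (by linarith)

/-- `‖λ‖ ≤ |t| log n`. [folklore] -/
theorem norm_dobnerShift_le {t : ℝ} (ht : t ≠ 0) {s : ℂ} (hs0 : 0 < s.im) (hs : |t| / 2 ≤ s.im)
    (n : ℕ) : ‖dobnerShift t n s‖ ≤ |t| * Real.log n := by
  have ht' : 0 < |t| := abs_pos.2 ht
  have hA := norm_dobnerA_ge ht hs0 hs
  have hℓ : 0 ≤ Real.log n := Real.log_natCast_nonneg n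
  have hA0 : 0 < ‖dobnerA t s‖ := lt_of_lt_of_le (by positivity) hA
  rw [dobnerShift, norm_div, Complex.norm_real, Real.norm_eq_abs, abs_of_nonneg hℓ, norm_mul,
    Complex.norm_ofNat, div_le_iff₀ (by positivity)]
  calc Real.log n = |t| * Real.log n * (2 * (1 / (2 * |t|))) := by field_simp
    _ ≤ |t| * Real.log n * (2 * ‖dobnerA t s‖) := by gcongr

/-! ## The integrand `𝓘(z) = γ(z) n^{−z} e^{(J_t(s) − z)²/|t|}` of `B_{t,n}(s)` -/

/-- The integrand `𝓘(z) = γ(z) n^{−z} e^{(J_t(s)−z)²/|t|}` of `B_{t,n}(s)` ([Dobner2021, eq. (4.1)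
and Lemma 6]). [cite: Dobner2021, Lemma 6] -/
def dobnerI (t : ℝ) (n : ℕ) (s z : ℂ) : ℂ :=
  xiGammaFactor z * (n : ℂ) ^ (-z) * Complex.exp (((1 / |t| : ℝ) : ℂ) * (dobnerJ t s - z) ^ 2)

/-- `B_{t,n}(s) = (π|t|)^{-1/2} ∫ 𝓘(2 + iv) dv`. [cite: Dobner2021, eq. (4.1)] -/
theorem dobnerB_eq_integral_dobnerI (t : ℝ) (n : ℕ) (s : ℂ) :
    dobnerB t n s = ((1 / Real.sqrt (Real.pi * |t|) : ℝ) : ℂ) * ∫ v : ℝ, dobnerI t n s (2 + v * I) :=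
  rfl

/-- The real part of `(J − z)²/|t|`. [folklore] -/
theorem re_gauss_exponent (t : ℝ) (J z : ℂ) :
    (((1 / |t| : ℝ) : ℂ) * (J - z) ^ 2).re = ((J.re - z.re) ^ 2 - (J.im - z.im) ^ 2) / |t| := by
  rw [Complex.re_ofReal_mul, sq, Complex.mul_re]
  simp only [Complex.sub_re, Complex.sub_im]
  ring

/-- **Modulus of the integrand**: `‖𝓘(z)‖ = ‖γ(z)‖ n^{−Re z} e^{((Re J − Re z)² − (Im J − Im z)²)/|t|}`
(`n ≥ 1`). [folklore] -/
theorem norm_dobnerI (t : ℝ) {n : ℕ} (hn : 1 ≤ n) (s z : ℂ) :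
    ‖dobnerI t n s z‖ = ‖xiGammaFactor z‖ * (n : ℝ) ^ (-z.re) *
      Real.exp ((((dobnerJ t s).re - z.re) ^ 2 - ((dobnerJ t s).im - z.im) ^ 2) / |t|) := by
  rw [dobnerI, norm_mul, norm_mul, Complex.norm_exp, re_gauss_exponent,
    Complex.norm_natCast_cpow_of_pos (by omega), Complex.neg_re]

/-- `𝓘` is differentiable off the closed negative real axis (`n ≥ 1`). [folklore] -/
theorem differentiableAt_dobnerI (t : ℝ) {n : ℕ} (hn : 1 ≤ n) (s : ℂ) {z : ℂ}
    (hz : 0 < z.re ∨ z.im ≠ 0) : DifferentiableAt ℂ (dobnerI t n s) z := by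
  unfold dobnerI
  refine ((differentiableAt_xiGammaFactor hz).mul ?_).mul (by fun_prop)
  exact differentiableAt_id.neg.const_cpow (Or.inl (by exact_mod_cast (show n ≠ 0 by omega)))

/-- `𝓘` is differentiable on the open right half-plane and on the open upper half-plane. [folklore] -/
theorem differentiableOn_dobnerI (t : ℝ) {n : ℕ} (hn : 1 ≤ n) (s : ℂ) :
    DifferentiableOn ℂ (dobnerI t n s) {z : ℂ | 0 < z.re ∨ z.im ≠ 0} := fun _ hz ↦
  (differentiableAt_dobnerI t hn s hz).differentiableWithinAt

/-- `v ↦ 𝓘(σ + iv)` is continuous for `σ > 0`. [folklore] -/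
theorem continuous_dobnerI_vertical (t : ℝ) {n : ℕ} (hn : 1 ≤ n) (s : ℂ) {σ : ℝ} (hσ : 0 < σ) :
    Continuous fun v : ℝ ↦ dobnerI t n s (σ + v * I) := by
  refine continuous_iff_continuousAt.2 fun v ↦ ?_
  have h : DifferentiableAt ℂ (dobnerI t n s) (σ + v * I) :=
    differentiableAt_dobnerI t hn s (Or.inl (by simpa using hσ))
  exact h.continuousAt.comp (f := fun v : ℝ ↦ (σ : ℂ) + v * I) (by fun_prop)

/-- `v ↦ 𝓘(r + i v)` is continuous for any real `r` as long as `v` stays positive: version on a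
horizontal... (we only need: `u ↦ 𝓘(c + iu)` continuous when `Im c + u > 0` always, i.e. as a map
on a set); here the pointwise form. [folklore] -/
theorem continuousAt_dobnerI_comp {t : ℝ} {n : ℕ} (hn : 1 ≤ n) (s : ℂ) {g : ℝ → ℂ} {u : ℝ}
    (hg : Continuous g) (hu : 0 < (g u).re ∨ (g u).im ≠ 0) :
    ContinuousAt (fun u : ℝ ↦ dobnerI t n s (g u)) u :=
  (differentiableAt_dobnerI t hn s hu).continuousAt.comp hg.continuousAt

/-- **Bound on vertical lines in the right half-plane**:
`‖𝓘(σ + iv)‖ ≤ π^{-σ/2} Γ(σ/2) (σ + 1 + |v|)² n^{−σ} e^{(Re J − σ)²/|t|} e^{−(Im J − v)²/|t|}` for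
`σ > 0`. [folklore] -/
theorem norm_dobnerI_vertical_le (t : ℝ) {n : ℕ} (hn : 1 ≤ n) (s : ℂ) {σ : ℝ} (hσ : 0 < σ)
    (v : ℝ) :
    ‖dobnerI t n s (σ + v * I)‖ ≤ Real.pi ^ (-σ / 2) * Real.Gamma (σ / 2) * (σ + 1 + |v|) ^ 2 *
      (n : ℝ) ^ (-σ) * Real.exp (((dobnerJ t s).re - σ) ^ 2 / |t|) *
        Real.exp (-(((dobnerJ t s).im - v) ^ 2 / |t|)) := by
  rw [norm_dobnerI t hn]
  have hγ := norm_xiGammaFactor_vertical_le (J := (σ : ℂ)) (by simpa using hσ) v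
  simp only [Complex.ofReal_re, Complex.norm_real, Real.norm_eq_abs, abs_of_pos hσ] at hγ
  have hre : ((σ : ℂ) + v * I).re = σ := by simp
  have him : ((σ : ℂ) + v * I).im = v := by simp
  rw [hre, him, sub_div, Real.exp_sub, div_eq_mul_inv (Real.exp _), ← Real.exp_neg]
  have h0 : 0 ≤ (n : ℝ) ^ (-σ) := Real.rpow_nonneg n.cast_nonneg _
  calc ‖xiGammaFactor (σ + v * I)‖ * (n : ℝ) ^ (-σ) *
        (Real.exp (((dobnerJ t s).re - σ) ^ 2 / |t|) * Real.exp (-(((dobnerJ t s).im - v) ^ 2 / |t|)))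
      ≤ Real.pi ^ (-σ / 2) * Real.Gamma (σ / 2) * (σ + 1 + |v|) ^ 2 * (n : ℝ) ^ (-σ) *
        (Real.exp (((dobnerJ t s).re - σ) ^ 2 / |t|) * Real.exp (-(((dobnerJ t s).im - v) ^ 2 / |t|))) := by
        gcongr
    _ = _ := by ring

/-- A Gaussian with a quadratic weight is integrable: `(K + |v − m|)² e^{−(m − v)²/b}`. [folklore] -/
theorem integrable_sq_mul_exp_neg_sq_div_shift (K m : ℝ) {b : ℝ} (hb : 0 < b) :
    Integrable fun v : ℝ ↦ (K + |v - m|) ^ 2 * Real.exp (-((m - v) ^ 2 / b)) := by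
  have h := (integrable_sq_mul_exp_neg_sq_div (K := K) hb).comp_sub_right m
  refine h.congr (Eventually.of_forall fun v ↦ ?_)
  simp only
  rw [show (m - v) ^ 2 = (v - m) ^ 2 by ring]

/-- **`v ↦ 𝓘(σ + iv)` is integrable** for `σ > 0` (`n ≥ 1`, `t ≠ 0`). [folklore] -/
theorem integrable_dobnerI_vertical {t : ℝ} (ht : t ≠ 0) {n : ℕ} (hn : 1 ≤ n) (s : ℂ) {σ : ℝ}
    (hσ : 0 < σ) : Integrable fun v : ℝ ↦ dobnerI t n s (σ + v * I) := by
  have ht' : 0 < |t| := abs_pos.2 ht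
  set J := dobnerJ t s with hJ
  set M : ℝ := Real.pi ^ (-σ / 2) * Real.Gamma (σ / 2) * (n : ℝ) ^ (-σ) *
    Real.exp ((J.re - σ) ^ 2 / |t|) with hM
  have hM0 : 0 ≤ M := by
    have := (Real.Gamma_pos_of_pos (show 0 < σ / 2 by linarith)).le
    positivity
  have hg := (integrable_sq_mul_exp_neg_sq_div_shift (σ + 1 + |J.im|) J.im ht').const_mul M
  refine hg.mono' (continuous_dobnerI_vertical t hn s hσ).aestronglyMeasurable
    (Eventually.of_forall fun v ↦ ?_)
  have h1 := norm_dobnerI_vertical_le t hn s hσ v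
  rw [← hJ] at h1
  have h2 : (σ + 1 + |v|) ^ 2 ≤ (σ + 1 + |J.im| + |v - J.im|) ^ 2 := by
    have : |v| ≤ |J.im| + |v - J.im| := by
      have := abs_add_le (J.im) (v - J.im); rwa [add_sub_cancel] at this
    have h0 : 0 ≤ σ + 1 + |v| := by positivity
    nlinarith [abs_nonneg (v - J.im), abs_nonneg J.im]
  calc ‖dobnerI t n s (σ + v * I)‖
      ≤ Real.pi ^ (-σ / 2) * Real.Gamma (σ / 2) * (σ + 1 + |v|) ^ 2 * (n : ℝ) ^ (-σ) *
          Real.exp ((J.re - σ) ^ 2 / |t|) * Real.exp (-((J.im - v) ^ 2 / |t|)) := h1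
    _ = M * ((σ + 1 + |v|) ^ 2 * Real.exp (-((J.im - v) ^ 2 / |t|))) := by rw [hM]; ring
    _ ≤ M * ((σ + 1 + |J.im| + |v - J.im|) ^ 2 * Real.exp (-((J.im - v) ^ 2 / |t|))) := by
        gcongr

/-- `Γ(σ/2) ≤ max(Γ(a/2), Γ(b/2))` for `σ ∈ [a, b]`, `a > 0` (convexity). [folklore] -/
theorem real_Gamma_half_le_max {a b σ : ℝ} (ha : 0 < a) (hσ : σ ∈ Set.Icc a b) :
    Real.Gamma (σ / 2) ≤ max (Real.Gamma (a / 2)) (Real.Gamma (b / 2)) := by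
  have hab : a ≤ b := hσ.1.trans hσ.2
  have hseg : σ / 2 ∈ segment ℝ (a / 2) (b / 2) := by
    rw [segment_eq_Icc (by linarith)]; exact ⟨by linarith [hσ.1], by linarith [hσ.2]⟩
  exact Real.convexOn_Gamma.le_on_segment (show a / 2 ∈ Set.Ioi (0 : ℝ) from by
      simp only [Set.mem_Ioi]; linarith)
    (show b / 2 ∈ Set.Ioi (0 : ℝ) from by simp only [Set.mem_Ioi]; linarith) hseg

/-- **Uniform bound on a vertical strip `Re z ∈ [a, b] ⊂ (0, ∞)`**:
`‖𝓘(σ + iT)‖ ≤ M e^{(Im J)²/|t|} (b + 1 + |T|)² e^{−T²/(2|t|)}` with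
`M = max(Γ(a/2), Γ(b/2)) e^{(|Re J| + b)²/|t|}`. [folklore] -/
theorem norm_dobnerI_strip_le {t : ℝ} (ht : t ≠ 0) {n : ℕ} (hn : 1 ≤ n) (s : ℂ) {a b : ℝ}
    (ha : 0 < a) {σ : ℝ} (hσ : σ ∈ Set.Icc a b) (T : ℝ) :
    ‖dobnerI t n s (σ + T * I)‖ ≤
      max (Real.Gamma (a / 2)) (Real.Gamma (b / 2)) *
        Real.exp ((|(dobnerJ t s).re| + b) ^ 2 / |t|) * Real.exp ((dobnerJ t s).im ^ 2 / |t|) *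
        ((b + 1 + |T|) ^ 2 * Real.exp (-(T ^ 2 / (2 * |t|)))) := by
  have ht' : 0 < |t| := abs_pos.2 ht
  have hpi := Real.pi_gt_three
  set J := dobnerJ t s with hJ
  have hσ0 : 0 < σ := ha.trans_le hσ.1
  have h1 := norm_dobnerI_vertical_le t hn s hσ0 T
  rw [← hJ] at h1
  -- the individual factors
  have f1 : Real.pi ^ (-σ / 2) ≤ 1 :=
    Real.rpow_le_one_of_one_le_of_nonpos (by linarith) (by linarith)
  have f2 := real_Gamma_half_le_max ha hσ
  have f3 : (σ + 1 + |T|) ^ 2 ≤ (b + 1 + |T|) ^ 2 := by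
    have : 0 ≤ σ + 1 + |T| := by positivity
    nlinarith [hσ.2, abs_nonneg T]
  have f4 : (n : ℝ) ^ (-σ) ≤ 1 :=
    Real.rpow_le_one_of_one_le_of_nonpos (by exact_mod_cast hn) (by linarith)
  have f5 : Real.exp ((J.re - σ) ^ 2 / |t|) ≤ Real.exp ((|J.re| + b) ^ 2 / |t|) := by
    refine Real.exp_le_exp.2 (div_le_div_of_nonneg_right ?_ ht'.le)
    have : |J.re - σ| ≤ |J.re| + b := by
      calc |J.re - σ| ≤ |J.re| + |σ| := abs_sub _ _
        _ ≤ |J.re| + b := by rw [abs_of_pos hσ0]; linarith [hσ.2]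
    calc (J.re - σ) ^ 2 = |J.re - σ| ^ 2 := (sq_abs _).symm
      _ ≤ (|J.re| + b) ^ 2 := pow_le_pow_left₀ (abs_nonneg _) this 2
  have f6 : Real.exp (-((J.im - T) ^ 2 / |t|)) ≤
      Real.exp (J.im ^ 2 / |t|) * Real.exp (-(T ^ 2 / (2 * |t|))) := by
    rw [← Real.exp_add, Real.exp_le_exp]
    have : T ^ 2 / 2 - J.im ^ 2 ≤ (J.im - T) ^ 2 := by nlinarith [sq_nonneg (J.im - T / 2)]
    have e1 : J.im ^ 2 / |t| + -(T ^ 2 / (2 * |t|)) = (J.im ^ 2 - T ^ 2 / 2) / |t| := by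
      field_simp; ring
    have e2 : -((J.im - T) ^ 2 / |t|) = (-(J.im - T) ^ 2) / |t| := by ring
    rw [e1, e2]
    exact div_le_div_of_nonneg_right (by linarith) ht'.le
  have hG0 : 0 ≤ max (Real.Gamma (a / 2)) (Real.Gamma (b / 2)) :=
    le_max_of_le_left (Real.Gamma_pos_of_pos (by linarith)).le
  calc ‖dobnerI t n s (σ + T * I)‖
      ≤ Real.pi ^ (-σ / 2) * Real.Gamma (σ / 2) * (σ + 1 + |T|) ^ 2 * (n : ℝ) ^ (-σ) *
          Real.exp ((J.re - σ) ^ 2 / |t|) * Real.exp (-((J.im - T) ^ 2 / |t|)) := h1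
    _ ≤ 1 * max (Real.Gamma (a / 2)) (Real.Gamma (b / 2)) * (b + 1 + |T|) ^ 2 * 1 *
          Real.exp ((|J.re| + b) ^ 2 / |t|) *
          (Real.exp (J.im ^ 2 / |t|) * Real.exp (-(T ^ 2 / (2 * |t|)))) := by
        gcongr
    _ = _ := by ring

/-- `(b + 1 + r)² e^{−r²/(2|t|)} → 0` as `r → ∞`. [folklore] -/
theorem tendsto_sq_mul_exp_neg_sq (b : ℝ) {c : ℝ} (hc : 0 < c) :
    Tendsto (fun r : ℝ ↦ (b + 1 + r) ^ 2 * Real.exp (-(r ^ 2 / c))) atTop (𝓝 0) := by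
  -- `u e^{-u} → 0` with `u = r²/c`, and `(b+1+r)² ≤ 4 r² = 4c u` for `r ≥ |b| + 1`
  have h1 : Tendsto (fun r : ℝ ↦ r ^ 2 / c) atTop atTop :=
    (tendsto_pow_atTop two_ne_zero).atTop_div_const hc
  have h2 : Tendsto (fun r : ℝ ↦ (r ^ 2 / c) ^ 1 * Real.exp (-(r ^ 2 / c))) atTop (𝓝 0) :=
    (Real.tendsto_pow_mul_exp_neg_atTop_nhds_zero 1).comp h1
  have h3 : Tendsto (fun r : ℝ ↦ 4 * c * ((r ^ 2 / c) ^ 1 * Real.exp (-(r ^ 2 / c)))) atTop (𝓝 0) := by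
    simpa using h2.const_mul (4 * c)
  refine tendsto_of_tendsto_of_tendsto_of_le_of_le' tendsto_const_nhds h3 ?_ ?_
  · exact Eventually.of_forall fun r ↦ by positivity
  · filter_upwards [eventually_ge_atTop (|b| + 1)] with r hr
    have hr0 : 0 ≤ r := by linarith [abs_nonneg b]
    have hb1 : b + 1 + r ≤ 2 * r := by linarith [le_abs_self b]
    have hb0 : 0 ≤ b + 1 + r := by linarith [neg_abs_le b]
    have key : (b + 1 + r) ^ 2 ≤ 4 * r ^ 2 := by nlinarith
    have e : 4 * c * ((r ^ 2 / c) ^ 1 * Real.exp (-(r ^ 2 / c))) =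
        4 * r ^ 2 * Real.exp (-(r ^ 2 / c)) := by field_simp
    rw [e]
    exact mul_le_mul_of_nonneg_right key (Real.exp_pos _).le

/-- **Shifting the line of integration inside `Re z > 0`**: for `0 < a ≤ b`,
`∫ 𝓘(a + iv) dv = ∫ 𝓘(b + iv) dv` (Cauchy's theorem on rectangles, `𝓘` is holomorphic on
`Re z > 0` and decays like a Gaussian at the ends of the strip). [cite: Dobner2021, proof of Lemma 4 (iii)] -/
theorem integral_dobnerI_vertical_eq {t : ℝ} (ht : t ≠ 0) {n : ℕ} (hn : 1 ≤ n) (s : ℂ) {a b : ℝ}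
    (ha : 0 < a) (hab : a ≤ b) :
    ∫ v : ℝ, dobnerI t n s (a + v * I) = ∫ v : ℝ, dobnerI t n s (b + v * I) := by
  have ht' : 0 < |t| := abs_pos.2 ht
  set J := dobnerJ t s with hJ
  refine MertensBoundRH.integral_vertical_eq_of_tendsto (dobnerI t n s) hab ?_
    (integrable_dobnerI_vertical ht hn s ha) (integrable_dobnerI_vertical ht hn s (ha.trans_le hab))
    fun ε hε ↦ ?_
  · refine (differentiableOn_dobnerI t hn s).mono fun z hz ↦ Or.inl ?_
    have h1 : z.re ∈ Set.Icc a b := hz.1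
    exact ha.trans_le h1.1
  · set M : ℝ := max (Real.Gamma (a / 2)) (Real.Gamma (b / 2)) *
      Real.exp ((|J.re| + b) ^ 2 / |t|) * Real.exp (J.im ^ 2 / |t|) with hM
    have hM0 : 0 ≤ M := by
      have : 0 ≤ max (Real.Gamma (a / 2)) (Real.Gamma (b / 2)) :=
        le_max_of_le_left (Real.Gamma_pos_of_pos (by linarith)).le
      positivity
    have hlim := (tendsto_sq_mul_exp_neg_sq b (show 0 < 2 * |t| by positivity)).const_mul M
    rw [mul_zero] at hlim
    obtain ⟨R₀, hR₀⟩ := eventually_atTop.1 (hlim.eventually (gt_mem_nhds hε))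
    refine ⟨max R₀ 0, fun σ hσ T hT ↦ ?_⟩
    have hT' : R₀ ≤ |T| := (le_max_left _ _).trans hT
    calc ‖dobnerI t n s (σ + T * I)‖
        ≤ M * ((b + 1 + |T|) ^ 2 * Real.exp (-(|T| ^ 2 / (2 * |t|)))) := by
          rw [sq_abs]; exact norm_dobnerI_strip_le ht hn s ha hσ T
      _ ≤ ε := (hR₀ |T| hT').le

end Literature.NumberTheory.LFunctions
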